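/-
Copyright (c) 2026 the pub-hodgecm-mathlib formalisation cell (harness21).  Prover seat hodgecm-mathlib-LH4-p12 (g7), req620 Track A «(D-RAM) FOUR-FRAME», line LH4
(STAGE-1b tier-0 regular row, (L-sq) labelled trunk brick (d) PART 4: THE ASSEMBLY — ★ TRUNK p857082's steps (3)–(6) VERBATIM over the label-cut partition ★ p859743, the
cells in box-sum currency ((d) PARTS 1–3) and the truncated box-sum `SqLabelledBoxSum` (LH4-p12 DEFS ★ p859958, proved by LH4-p10 (g6)) as a HYPOTHESIS).  2026-09-04.
-/
import Summits.HodgeConjecture.HodgeConjecture.Theorems.F0P3cDyRamSqLabelledCellsCorner        -- (d) PART 3 (this seat): brings PARTS 1–2, the cells, the letters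
import Summits.HodgeConjecture.HodgeConjecture.Theorems.F0P3cDyRamLabelledKappaStrataPartition   -- ★ p859743 (this seat): the label-cut partition + off-shape vanishing
import Summits.HodgeConjecture.HodgeConjecture.Theorems.F0P3cDyRamKappaCountTypeZeroSigned      -- ★ p857082 TRUNK (for its tool opens: glue witnesses' letters, `normSign_one_add_eq_one`, …)
import Literature.Uncategorized.SqLabelledBoxSum                                                  -- ★ p859958: the named arithmetic Prop `SqLabelledBoxSum`
import HarnessLib

/-!
# Crux `H413`, line LH4 «(D-RAM) FOUR-FRAME» — (d) PART 4: THE LABELLED TRUNK OF THE SQUARE LAW, ASSEMBLED MODULO `SqLabelledBoxSum`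

`labelledTrunk_sq_of_boxSum (hbox : SqLabelledBoxSum) …` : for a wild datum, ANY element datum `(α, β; n₁, n₂, n₃)` at the depth of record UNDER THE FENCE `2d ≤ nᵢ + 1`
(true for the square data of the law, ★ p859917), `T = diag(α, β, 1)`, `2k + d = Σn + 2`, slot `i`, `2B = nᵢ − d + 2 − 2·shiftR d t`, three σ-fixed glue witnesses at precision
`n_apex − d + 1`, and a label level `ℓ` with `ℓ + 1 = d % 2 + 2d` (`ℓ = mstarOfRecord d`):
`Σᶠ_{M ∈ 𝓛₀(T), dualisable, diag((α−1)², (β−1)², 0)·M ⊆ ϖ^ℓ·M} κ₀,ᵢ(M)·w(M) = WTOK · ampl(q, k − cs, B − cs)∕4`, `cs = (d+1)∕2 = csOfRecord d`, `WTOK` = ★ p857082's witness token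
table VERBATIM — i.e. the `hTrunk` binder of ★ p859650 at `lb d = ℓ`, `A = amplCs` (★ DEFS №5: `amplCs q d t k B = ampl q (k − csOfRecord d) (B − csOfRecord d)`), plus the fence.
PROOF = ★ p857082's body with three substitutions: the partition is ★ p859743's label-cut one; the eight socket feeds are the cells `cell_core ∕ cell_T1–T3 ∕ cell_G1–G3 ∕ cell_H`
((d) PARTS 1–3) and the off-shape vanishing ★ `finsum_stratum_sep_eq_zero_of_not_shape`; the box-sum is `hbox`; the final arithmetic tiles `[k − B, k − cs − 1]`
(`max 0 (q^{k−cs} − q^{k−B}) = q^{k−cs} − q^{k−max(cs,B′)}`).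

HONEST LABEL: helper lane (`--supports stmt-HodgeConjecture-24833`), count-neutral; a composition — `SqLabelledBoxSum` is a HYPOTHESIS until LH4-p10's `_holds` lands; pays no
tier-0 row by itself (T₊∕T₋∕reg OPEN); HC_CM is proved only modulo the 7 printed citations (2 remaining named inputs: hLiu418 = stmt-HodgeConjecture-24832, h413 =
stmt-HodgeConjecture-24833) until rung 0 closes.

## References (NEVER `[KR2]`)
* [Kottwitz1986BaseChangeUnits] R. E. Kottwitz, *Base change for unit elements of Hecke algebras*, Compositio Math. 60 (1986), §1 pp. 240–241.
* [Rogawski1990] J. D. Rogawski, *Automorphic Representations of Unitary Groups in Three Variables*, Ann. of Math. Stud. 123 (1990), §4.9 Prop. 4.9.1 (a) p. 55, §4.10 p. 58.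
* [LanglandsShelstad1987] R. P. Langlands, D. Shelstad, *On the definition of transfer factors*, Math. Ann. 278 (1987), §3.
* [Serre1979] J.-P. Serre, *Local Fields*, GTM 67 (1979), Ch. V §3 Prop. 5, Cor. 3.
-/

set_option autoImplicit false

noncomputable section

namespace Summit.HodgeConjecture.HodgeConjecture.Cruxes.H413.F0P3cDyRamSqLabelledTrunkOfBoxSum

open Finset
open Literature.NumberTheory.Automorphic Literature.NumberTheory.Automorphic.HermitianLattice
open Literature.NumberTheory.Automorphic.UnitaryLatticeTree Literature.NumberTheory.Automorphic.UnitaryThreeFourFrame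
open Literature.NumberTheory.LocalFields Literature.NumberTheory.LocalFields.WildQuadraticDatum
open Summit.HodgeConjecture.HodgeConjecture.Cruxes.H413.F0P3cDyRamFourFrameLawDefsR (shiftR)
open Summit.HodgeConjecture.HodgeConjecture.Cruxes.H413.F0P3cDyRamDiagonalTorusDefs
open Summit.HodgeConjecture.HodgeConjecture.Cruxes.H413.F0P3cDyRamDiagonalStrataDefs
open Summit.HodgeConjecture.HodgeConjecture.Cruxes.H413.F0P3cDyRamDiagonalKappaCountDefs
open Summit.HodgeConjecture.HodgeConjecture.Cruxes.H413.F0P3cDyRamStrataPartition (finsum_mem_eq_sum_box_finsum_mem_hasAxis)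
open Summit.HodgeConjecture.HodgeConjecture.Cruxes.H413.F0P3cDyRamDiagonalStrataAxis (exists_hasAxis hasAxis_unique)
open Summit.HodgeConjecture.HodgeConjecture.Cruxes.H413.F0P3cDyRamDiagonalStrataShapes (hasAxis_shapes)
open Summit.HodgeConjecture.HodgeConjecture.Cruxes.H413.F0P3cDyRamDiagonalKappaSplitCountSockets
open Summit.HodgeConjecture.HodgeConjecture.Cruxes.H413.F0P3cDyRamDiagonalKappaGluedSocket (finsum_kappaCount_mul_stabiliserWeight_hasAxis_G1)
open Summit.HodgeConjecture.HodgeConjecture.Cruxes.H413.F0P3cDyRamDiagonalKappaGluedRotations (finsum_kappaCount_mul_stabiliserWeight_hasAxis_G2 finsum_kappaCount_mul_stabiliserWeight_hasAxis_G3)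
open Summit.HodgeConjecture.HodgeConjecture.Cruxes.H413.F0P3cDyRamDiagonalKappaCoreHangingSocket (finsum_kappaCount_mul_stabiliserWeight_hasAxis_H)
open Summit.HodgeConjecture.HodgeConjecture.Cruxes.H413.F0P3cDyRamElementDatumParity
open Summit.HodgeConjecture.HodgeConjecture.Cruxes.H413.F0P3cDyRamStableCountTypeZero (v_diag_eq_one diag_regular finite_normalisedStableLattices)
open Summit.HodgeConjecture.HodgeConjecture.Cruxes.H413.F0P3cDyRamGlueUnitRationalityDepth (exists_fixed_v_add_glueUnit_le_iff)
open Summit.HodgeConjecture.HodgeConjecture.Cruxes.H413.F0P3cDyRamDiagonalPermutation (isElementDatum_swap isElementDatum_rescale)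
open Summit.HodgeConjecture.HodgeConjecture.Cruxes.H413.F0P3cDyRamKappaAssemblyTools
open Summit.HodgeConjecture.HodgeConjecture.Cruxes.H413.F0P3cDyRamDiagonalKappaCoreHangingClass (two_le_d_of_v_two_lt_one)
open scoped Valued WithZero Matrix MatrixGroups
open Summit.HodgeConjecture.HodgeConjecture.Cruxes.H413.F0P3cDyRamKappaCountBoxSum (sum_box_kappa_eq_typeZero)
open Summit.HodgeConjecture.HodgeConjecture.Cruxes.H413.F0P3cDyRamFourFrameCensusDefs
open Summit.HodgeConjecture.HodgeConjecture.Cruxes.H413.F0P3cDyRamLabelledKappaStrataPartition (finsum_mem_sep_eq_sum_box_finsum_stratum_sep_kappa finsum_stratum_sep_eq_zero_of_not_shape)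
open Summit.HodgeConjecture.HodgeConjecture.Cruxes.H413.F0P3cDyRamSqLabelledCellsSplit (cell_core cell_T1 cell_T2 cell_T3)
open Summit.HodgeConjecture.HodgeConjecture.Cruxes.H413.F0P3cDyRamSqLabelledCellsGlued (cell_G1 cell_G2)
open Summit.HodgeConjecture.HodgeConjecture.Cruxes.H413.F0P3cDyRamSqLabelledCellsCorner (cell_G3 cell_H)


/-- **THE LABELLED TRUNK OF THE SQUARE LAW MODULO THE TRUNCATED BOX-SUM.**  GIVEN `SqLabelledBoxSum` (the ★ p856906 box-sum with the glue-foot ∕ hanging truncation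
`2ρ + (d%2+2d) ≤ 2·n_plane + 1` and the fence), for every wild datum, every element datum at `depthOfRecord d` UNDER THE FENCE `2d ≤ nᵢ + 1`, a level `ℓ` with `ℓ + 1 = d%2 + 2d`,
`T = diag(α, β, 1)`, `2k + d = Σn + 2`, slot `i`, `2B = nᵢ − d + 2 − 2·shiftR d t` and three σ-fixed glue witnesses at precision `n_apex − d + 1`:
`Σᶠ_{M ∈ 𝓛₀(T), dualisable, LatticeInLevel ϖ ℓ (diag((α−1)², (β−1)², 0)) M} κ₀,ᵢ(M)·w(M) = WTOK · ampl(q, k − (d+1)∕2, B − (d+1)∕2)∕4` (`WTOK` = ★ p857082's witness token table).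
[cite: Kottwitz1986BaseChangeUnits, §1 pp. 240–241] [cite: Rogawski1990, §4.9 Prop. 4.9.1 (a) p. 55; §4.10 p. 58] [cite: LanglandsShelstad1987, §3] [cite: Serre1979, Ch. V §3 Prop. 5, Cor. 3] -/
theorem labelledTrunk_sq_of_boxSum (hbox : Literature.Uncategorized.SqLabelledBoxSum)
    {K : Type} [Field K] [Valued K ℤᵐ⁰] [CompleteSpace K] [Fintype 𝓀[K]] {σ : K →+* K} {ϖ : K} {d t : ℕ} (hD : IsRamifiedQuadraticDatum σ ϖ d t)
    (h2 : Valued.v (2 : K) < 1) {α β : K} {n₁ n₂ n₃ : ℕ} (hE : IsElementDatum σ ϖ (depthOfRecord d) α β n₁ n₂ n₃)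
    (hfence : 2 * d ≤ n₁ + 1 ∧ 2 * d ≤ n₂ + 1 ∧ 2 * d ≤ n₃ + 1) {ℓ : ℕ} (hℓ : ℓ + 1 = d % 2 + 2 * d)
    (T : GL (Fin 3) K) (hT : (T : Matrix (Fin 3) (Fin 3) K) = Matrix.diagonal ![α, β, 1]) (k : ℕ) (hk : 2 * k + d = n₁ + n₂ + n₃ + 2)
    (i : Fin 3) (B : ℤ) (hB : 2 * B = ((![n₁, n₂, n₃] : Fin 3 → ℕ) i : ℤ) - d + 2 - 2 * shiftR d t)
    {f₀ f₁ f₂ : K} (hσf₀ : σ f₀ = f₀) (hσf₁ : σ f₁ = f₁) (hσf₂ : σ f₂ = f₂)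
    (hf₀ : n₂ = n₃ → n₂ ≤ n₁ → Valued.v (f₀ + (β - 1) / (α - 1)) ≤ Valued.v ϖ ^ (n₁ - d + 1))
    (hf₁ : n₁ = n₃ → n₁ ≤ n₂ → Valued.v (f₁ + (α - 1) / (β - 1)) ≤ Valued.v ϖ ^ (n₂ - d + 1))
    (hf₂' : n₂ = n₁ → n₂ ≤ n₃ → Valued.v (f₂ + (β * α⁻¹ - 1) / (α⁻¹ - 1)) ≤ Valued.v ϖ ^ (n₃ - d + 1)) :
    ∑ᶠ M ∈ {M : Submodule 𝒪[K] (Fin 3 → K) | M ∈ normalisedStableLattices T ∧ IsDualisableLattice σ ϖ M ∧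
        LatticeInLevel ϖ ℓ (Matrix.diagonal ![(α - 1) * (α - 1), (β - 1) * (β - 1), 0]) M},
        (kappaCount σ ϖ 0 i M : ℚ) * stabiliserWeight σ M =
      (if n₁ = n₂ ∧ n₂ = n₃ then ((((![normSign σ (-(1 + f₀)), normSign σ f₀ * normSign σ (-(1 + f₀)), normSign σ f₀] : Fin 3 → ℤ) i : ℤ) : ℚ))
      else if n₂ = n₃ then (![![(normSign σ (-1 : K) : ℚ) * normSign σ (1 + f₀), (normSign σ (-1 : K) : ℚ) * normSign σ f₀ * normSign σ (1 + f₀), (normSign σ f₀ : ℚ)],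
         ![(normSign σ (-1 : K) : ℚ) * normSign σ f₁ * normSign σ (1 + f₁), (normSign σ (-1 : K) : ℚ) * normSign σ (1 + f₁), (normSign σ f₁ : ℚ)],
         ![(normSign σ f₂ : ℚ), (normSign σ (-1 : K) : ℚ) * normSign σ f₂ * normSign σ (1 + f₂), (normSign σ (-1 : K) : ℚ) * normSign σ (1 + f₂)]] : Fin 3 → Fin 3 → ℚ) 0 i
      else if n₁ = n₃ then (![![(normSign σ (-1 : K) : ℚ) * normSign σ (1 + f₀), (normSign σ (-1 : K) : ℚ) * normSign σ f₀ * normSign σ (1 + f₀), (normSign σ f₀ : ℚ)],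
         ![(normSign σ (-1 : K) : ℚ) * normSign σ f₁ * normSign σ (1 + f₁), (normSign σ (-1 : K) : ℚ) * normSign σ (1 + f₁), (normSign σ f₁ : ℚ)],
         ![(normSign σ f₂ : ℚ), (normSign σ (-1 : K) : ℚ) * normSign σ f₂ * normSign σ (1 + f₂), (normSign σ (-1 : K) : ℚ) * normSign σ (1 + f₂)]] : Fin 3 → Fin 3 → ℚ) 1 i
      else (![![(normSign σ (-1 : K) : ℚ) * normSign σ (1 + f₀), (normSign σ (-1 : K) : ℚ) * normSign σ f₀ * normSign σ (1 + f₀), (normSign σ f₀ : ℚ)],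
         ![(normSign σ (-1 : K) : ℚ) * normSign σ f₁ * normSign σ (1 + f₁), (normSign σ (-1 : K) : ℚ) * normSign σ (1 + f₁), (normSign σ f₁ : ℚ)],
         ![(normSign σ f₂ : ℚ), (normSign σ (-1 : K) : ℚ) * normSign σ f₂ * normSign σ (1 + f₂), (normSign σ (-1 : K) : ℚ) * normSign σ (1 + f₂)]] : Fin 3 → Fin 3 → ℚ) 2 i) *
        (ampl (Fintype.card 𝓀[K]) (k - (d + 1) / 2) (B - (((d + 1) / 2 : ℕ) : ℤ)) / 4) := by
  have hD' := hD
  obtain ⟨hσ, hvσ, hϖ, hfix, hdϖ, hd1, -⟩ := hD'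
  have hd2 : 2 ≤ d := two_le_d_of_v_two_lt_one hD h2
  have hN₀ : d ≤ depthOfRecord d := by unfold depthOfRecord; split_ifs <;> omega
  have hϖ1 : Valued.v ϖ ≤ 1 := by rw [hϖ, ← WithZero.exp_zero, WithZero.exp_le_exp]; norm_num
  have hE' := hE
  obtain ⟨hαn, hβn, hαβ, hα1, hβ1, h₁, h₂, h₃, hN₁, hN₂, hN₃⟩ := hE'
  -- (1)–(2) the label-cut summation set is the box sum of its label-cut strata (★ p859743)
  rw [finsum_mem_sep_eq_sum_box_finsum_stratum_sep_kappa hD hE T hT i ℓ _]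
  -- (3) the glue witnesses of the three feet are BINDERS here (foot 0 ∕ H share `(β−1)∕(α−1)`; feet 1, 2 live on the swapped ∕ rescaled element data)
  have hα0 : α ≠ 0 := fun h => by rw [h, zero_mul] at hαn; exact zero_ne_one hαn
  have hf₂ : n₂ = n₁ → n₂ ≤ n₃ → Valued.v (f₂ + (β - α) / (1 - α)) ≤ Valued.v ϖ ^ (n₃ - d + 1) := by
    intro h21 h23
    -- the glue unit of the rescaled datum: `(βα⁻¹ − 1)∕(α⁻¹ − 1) = (β − α)∕(1 − α)` (as in ★ `…KappaGluedRotations`)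
    have key : (β * α⁻¹ - 1) / (α⁻¹ - 1) = (β - α) / (1 - α) := by
      have h1α : (1 : K) - α ≠ 0 := sub_ne_zero.2 (Ne.symm hα1)
      have hi : α⁻¹ - 1 = (1 - α) * α⁻¹ := by field_simp
      have hn : β * α⁻¹ - 1 = (β - α) * α⁻¹ := by field_simp
      rw [hi, hn, mul_div_mul_right _ _ (inv_ne_zero hα0)]
    rw [← key]; exact hf₂' h21 h23
  -- (4) the glue-shell guards of the four socket families from the three witnesses
  have hglue₀ : ∀ ρ s : ℕ, 2 ∣ s → n₂ = n₃ → n₁ = n₂ + s → n₂ < 2 * ρ → 2 * ρ - n₂ ≤ n₂ - d + 1 →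
      Valued.v (f₀ + (β - 1) / (α - 1)) ≤ Valued.v ϖ ^ (2 * ρ + s - n₂) := fun ρ s _ h23 h1s hlt hle =>
    (hf₀ h23 (by omega)).trans (pow_le_pow_right_of_le_one' hϖ1 (by omega))
  have hglue₁ : ∀ ρ s : ℕ, 2 ∣ s → n₁ = n₃ → n₂ = n₁ + s → n₁ < 2 * ρ → 2 * ρ - n₁ ≤ n₁ - d + 1 →
      Valued.v (f₁ + (α - 1) / (β - 1)) ≤ Valued.v ϖ ^ (2 * ρ + s - n₁) := fun ρ s _ h13 h2s hlt hle =>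
    (hf₁ h13 (by omega)).trans (pow_le_pow_right_of_le_one' hϖ1 (by omega))
  have hglue₂ : ∀ ρ s : ℕ, 2 ∣ s → n₂ = n₁ → n₃ = n₂ + s → n₂ < 2 * ρ → 2 * ρ - n₂ ≤ n₂ - d + 1 →
      Valued.v (f₂ + (β - α) / (1 - α)) ≤ Valued.v ϖ ^ (2 * ρ + s - n₂) := fun ρ s _ h21 h3s hlt hle =>
    (hf₂ h21 (by omega)).trans (pow_le_pow_right_of_le_one' hϖ1 (by omega))
  have hglueH : ∀ ρ : ℕ, n₁ = n₂ → n₂ = n₃ → n₁ < 2 * ρ → 2 * ρ - n₁ ≤ n₁ - d + 1 →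
      Valued.v (f₀ + (β - 1) / (α - 1)) ≤ Valued.v ϖ ^ (2 * ρ - n₁) := fun ρ h12 h23 hlt hle =>
    (hf₀ h23 (by omega)).trans (pow_le_pow_right_of_le_one' hϖ1 (by omega))
  -- the «apex with excess ≥ 2d» guards: there the glue witness is `2d`-deep, so `ω(1 + f) = 1`
  have hvϖ0 : Valued.v ϖ ≠ 0 := by rw [hϖ]; exact WithZero.coe_ne_zero
  have hdeep : ∀ {f g : K} {e m : ℕ}, Valued.v (f + g) ≤ Valued.v ϖ ^ e → Valued.v g = Valued.v ϖ ^ m → 2 * d ≤ e → 2 * d ≤ m →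
      Valued.v f ≤ Valued.v ϖ ^ (2 * d) := by
    intro f g e m hfg hg he hm
    have ef : f = (f + g) - g := by ring
    rw [ef]
    refine (Valuation.map_sub _ _ _).trans (max_le ?_ ?_)
    · exact hfg.trans (pow_le_pow_right_of_le_one' hϖ1 he)
    · rw [hg]; exact pow_le_pow_right_of_le_one' hϖ1 hm
  have hβ0 : β ≠ 0 := fun h => by rw [h, zero_mul] at hβn; exact zero_ne_one hβn
  have hω0 : i = 0 → n₂ = n₃ → n₂ + 2 * d ≤ n₁ →
      (![![(normSign σ (-1 : K) : ℚ) * normSign σ (1 + f₀), (normSign σ (-1 : K) : ℚ) * normSign σ f₀ * normSign σ (1 + f₀), (normSign σ f₀ : ℚ)],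
         ![(normSign σ (-1 : K) : ℚ) * normSign σ f₁ * normSign σ (1 + f₁), (normSign σ (-1 : K) : ℚ) * normSign σ (1 + f₁), (normSign σ f₁ : ℚ)],
         ![(normSign σ f₂ : ℚ), (normSign σ (-1 : K) : ℚ) * normSign σ f₂ * normSign σ (1 + f₂), (normSign σ (-1 : K) : ℚ) * normSign σ (1 + f₂)]] : Fin 3 → Fin 3 → ℚ) 0 0 =
        (normSign σ (-1 : K) : ℚ) := by
    intro _ h23 hle
    have hg : Valued.v ((β - 1) / (α - 1)) = Valued.v ϖ ^ (n₁ - n₂) := by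
      rw [map_div₀, h₁, h₂, div_eq_iff (pow_ne_zero _ hvϖ0), ← pow_add, Nat.sub_add_cancel (by omega)]
    have h1 := normSign_one_add_eq_one hD hσf₀ (hdeep (hf₀ h23 (by omega)) hg (by omega) (by omega))
    show (normSign σ (-1 : K) : ℚ) * normSign σ (1 + f₀) = _
    rw [h1, Int.cast_one, mul_one]
  have hω1 : i = 1 → n₁ = n₃ → n₁ + 2 * d ≤ n₂ →
      (![![(normSign σ (-1 : K) : ℚ) * normSign σ (1 + f₀), (normSign σ (-1 : K) : ℚ) * normSign σ f₀ * normSign σ (1 + f₀), (normSign σ f₀ : ℚ)],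
         ![(normSign σ (-1 : K) : ℚ) * normSign σ f₁ * normSign σ (1 + f₁), (normSign σ (-1 : K) : ℚ) * normSign σ (1 + f₁), (normSign σ f₁ : ℚ)],
         ![(normSign σ f₂ : ℚ), (normSign σ (-1 : K) : ℚ) * normSign σ f₂ * normSign σ (1 + f₂), (normSign σ (-1 : K) : ℚ) * normSign σ (1 + f₂)]] : Fin 3 → Fin 3 → ℚ) 1 1 =
        (normSign σ (-1 : K) : ℚ) := by
    intro _ h13 hle
    have hg : Valued.v ((α - 1) / (β - 1)) = Valued.v ϖ ^ (n₂ - n₁) := by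
      rw [map_div₀, h₁, h₂, div_eq_iff (pow_ne_zero _ hvϖ0), ← pow_add, Nat.sub_add_cancel (by omega)]
    have h1 := normSign_one_add_eq_one hD hσf₁ (hdeep (hf₁ h13 (by omega)) hg (by omega) (by omega))
    show (normSign σ (-1 : K) : ℚ) * normSign σ (1 + f₁) = _
    rw [h1, Int.cast_one, mul_one]
  have hω2 : i = 2 → n₁ = n₂ → n₁ + 2 * d ≤ n₃ →
      (![![(normSign σ (-1 : K) : ℚ) * normSign σ (1 + f₀), (normSign σ (-1 : K) : ℚ) * normSign σ f₀ * normSign σ (1 + f₀), (normSign σ f₀ : ℚ)],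
         ![(normSign σ (-1 : K) : ℚ) * normSign σ f₁ * normSign σ (1 + f₁), (normSign σ (-1 : K) : ℚ) * normSign σ (1 + f₁), (normSign σ f₁ : ℚ)],
         ![(normSign σ f₂ : ℚ), (normSign σ (-1 : K) : ℚ) * normSign σ f₂ * normSign σ (1 + f₂), (normSign σ (-1 : K) : ℚ) * normSign σ (1 + f₂)]] : Fin 3 → Fin 3 → ℚ) 2 2 =
        (normSign σ (-1 : K) : ℚ) := by
    intro _ h12 hle
    have hg : Valued.v ((β - α) / (1 - α)) = Valued.v ϖ ^ (n₃ - n₂) := by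
      rw [map_div₀, Valuation.map_sub_swap _ β α, h₃, Valuation.map_sub_swap _ 1 α, h₂, div_eq_iff (pow_ne_zero _ hvϖ0), ← pow_add,
        Nat.sub_add_cancel (by omega)]
    have h1 := normSign_one_add_eq_one hD hσf₂ (hdeep (hf₂ h12.symm (by omega)) hg (by omega) (by omega))
    show (normSign σ (-1 : K) : ℚ) * normSign σ (1 + f₂) = _
    rw [h1, Int.cast_one, mul_one]
  -- the foot-2 socket ★ `…_hasAxis_G3` is typed `n₂`-based (`n₂ = n₁`, `min n₂ n₁`, `⌈(2ρ−n₂)∕2⌉`); `hbox` reads it `n₁`-based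
  -- off the ★ B3 shape list a label-cut stratum is `0` (★ p859743)
  have hzero : ∀ a : Fin 3 → ℕ, ¬ ((a = ![0, 0, 0]) ∨
      (∃ s, 2 ∣ s ∧ 2 ≤ s ∧ (a = ![0, s, s] ∨ a = ![s, 0, s] ∨ a = ![s, s, 0])) ∨
      (∃ ρ s, 1 ≤ ρ ∧ 2 ∣ s ∧ 2 ≤ s ∧ (a = ![2 * ρ, 2 * ρ + s, 2 * ρ + s] ∨ a = ![2 * ρ + s, 2 * ρ, 2 * ρ + s] ∨ a = ![2 * ρ + s, 2 * ρ + s, 2 * ρ])) ∨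
      (∃ ρ, 1 ≤ ρ ∧ a = ![2 * ρ, 2 * ρ, 2 * ρ])) →
      (fun a => ∑ᶠ M ∈ {M | M ∈ stratum σ ϖ T a ∧ LatticeInLevel ϖ ℓ (Matrix.diagonal ![(α - 1) * (α - 1), (β - 1) * (β - 1), 0]) M},
        (kappaCount σ ϖ 0 i M : ℚ) * stabiliserWeight σ M) a = 0 :=
    fun a ha => finsum_stratum_sep_eq_zero_of_not_shape hD T _ _ a ha
  -- (5) the truncated labelled box sum `SqLabelledBoxSum` (LH4-p12 DEFS ★ p859958; proof LH4-p10) fed with the cells in its currency ((d) PARTS 1–3)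
  obtain ⟨hp1, hp2, hp3⟩ := depth_mod_two_eq_of_isElementDatum hD hE hN₀
  unfold Literature.Uncategorized.SqLabelledBoxSum at hbox
  have key := hbox (Fintype.card 𝓀[K]) hd2 (isoceles_of_isElementDatum hD hE) hfence hp1 hp2 hp3 le_rfl hk i
    ((normSign σ (-1 : K) : ℚ))
    ((((![normSign σ (-(1 + f₀)), normSign σ f₀ * normSign σ (-(1 + f₀)), normSign σ f₀] : Fin 3 → ℤ) i : ℤ) : ℚ))
    (![![(normSign σ (-1 : K) : ℚ) * normSign σ (1 + f₀), (normSign σ (-1 : K) : ℚ) * normSign σ f₀ * normSign σ (1 + f₀), (normSign σ f₀ : ℚ)],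
       ![(normSign σ (-1 : K) : ℚ) * normSign σ f₁ * normSign σ (1 + f₁), (normSign σ (-1 : K) : ℚ) * normSign σ (1 + f₁), (normSign σ f₁ : ℚ)],
       ![(normSign σ f₂ : ℚ), (normSign σ (-1 : K) : ℚ) * normSign σ f₂ * normSign σ (1 + f₂), (normSign σ (-1 : K) : ℚ) * normSign σ (1 + f₂)]])
    hω0 hω1 hω2
    (fun a => ∑ᶠ M ∈ {M | M ∈ stratum σ ϖ T a ∧ LatticeInLevel ϖ ℓ (Matrix.diagonal ![(α - 1) * (α - 1), (β - 1) * (β - 1), 0]) M},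
      (kappaCount σ ϖ 0 i M : ℚ) * stabiliserWeight σ M)
    (cell_core hD hE hT i ℓ)
    (fun s hs => cell_T1 hD hE hN₀ hT hfence hℓ s hs i)
    (fun s hs => cell_T2 hD hE hN₀ hT hfence hℓ s hs i)
    (fun s hs => cell_T3 hD h2 hE hN₀ hT hfence hℓ s hs i)
    (fun ρ s hρ hs => cell_G1 hD h2 hE hN₀ hT hfence hℓ ρ s hρ hs i f₀ hσf₀ (hglue₀ ρ s))
    (fun ρ s hρ hs => cell_G2 hD h2 hE hN₀ hT hfence hℓ ρ s hρ hs i f₁ hσf₁ (hglue₁ ρ s))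
    (fun ρ s hρ hs => cell_G3 hD h2 hE hN₀ hT hfence hℓ ρ s hρ hs i f₂ hσf₂ (hglue₂ ρ s))
    (fun ρ hρ => cell_H hD h2 hE hN₀ hT hfence hℓ ρ hρ i f₀ hσf₀ (hglueH ρ))
    hzero
  -- (6) arithmetic: divide by `q − 1`, and `max(0, q^k − q^{k−B}) = q^k − q^{k−B′}` (NO absolute value: the token stays)
  set q : ℕ := Fintype.card 𝓀[K] with hq_def
  have hq1 : (1 : ℚ) < q := by exact_mod_cast (Fintype.one_lt_card : 1 < Fintype.card 𝓀[K])
  have hq1' : (q : ℚ) - 1 ≠ 0 := by linarith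
  have hq0 : (0 : ℚ) < q := by linarith
  -- the exponent bookkeeping: `2B = nᵢ − d + 2 − 2·shiftR d t`, `shiftR d t = d − d % 2`
  have hshift : shiftR d t = ((d - d % 2 : ℕ) : ℤ) := rfl
  rw [hshift] at hB
  have hni : ((![n₁, n₂, n₃] : Fin 3 → ℕ) i) ≤ n₁ + n₂ + n₃ ∧ ((![n₁, n₂, n₃] : Fin 3 → ℕ) i) % 2 = d % 2 := by
    fin_cases i
    · exact ⟨by simp; omega, by simpa using hp1⟩
    · exact ⟨by simp; omega, by simpa using hp2⟩
    · exact ⟨by simp, by simpa using hp3⟩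
  set nᵢ : ℕ := ((![n₁, n₂, n₃] : Fin 3 → ℕ) i) with hnᵢ_def
  set cs : ℕ := (d + 1) / 2 with hcs_def
  have hcsk : cs ≤ k := by omega
  have hnum : max 0 ((q : ℚ) ^ ((k - cs : ℕ) : ℤ) - (q : ℚ) ^ (((k - cs : ℕ) : ℤ) - (B - (cs : ℤ)))) =
      (q : ℚ) ^ (k - cs) - (q : ℚ) ^ (k - max cs ((nᵢ + 2 * (d % 2) + 2 - 3 * d) / 2)) := by
    have hexp0 : ((k - cs : ℕ) : ℤ) - (B - (cs : ℤ)) = (k : ℤ) - B := by push_cast [Nat.cast_sub hcsk]; ring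
    rw [hexp0, zpow_natCast]
    by_cases hnn : 3 * d ≤ nᵢ + 2 * (d % 2) + 2 ∧ cs ≤ (nᵢ + 2 * (d % 2) + 2 - 3 * d) / 2
    · -- `B = B′ ≥ cs`: the window is alive below its top `cs` layers
      obtain ⟨hnn, hcsB⟩ := hnn
      have hdd : d % 2 ≤ d := Nat.mod_le d 2
      have hBB : B = (((nᵢ + 2 * (d % 2) + 2 - 3 * d) / 2 : ℕ) : ℤ) := by omega
      have hBk : (nᵢ + 2 * (d % 2) + 2 - 3 * d) / 2 ≤ k := by omega
      have hexp : (k : ℤ) - B = (((k - (nᵢ + 2 * (d % 2) + 2 - 3 * d) / 2 : ℕ)) : ℤ) := by omega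
      rw [hexp, zpow_natCast, max_eq_right hcsB]
      exact max_eq_right (sub_nonneg.2 (pow_le_pow_right₀ hq1.le (by omega)))
    · -- `B < cs`: dead — both sides vanish
      have hmax : max cs ((nᵢ + 2 * (d % 2) + 2 - 3 * d) / 2) = cs := max_eq_left (by omega)
      have hBle : ((k - cs : ℕ) : ℤ) ≤ (k : ℤ) - B := by omega
      rw [hmax, sub_self]
      exact max_eq_left (sub_nonpos.2 (by rw [← zpow_natCast]; exact zpow_le_zpow_right₀ hq1.le hBle))
  unfold ampl
  rw [hnum]
  have hsum : ∑ a : Fin 3 → Fin (n₁ + n₂ + n₃ + 1), (fun a => ∑ᶠ M ∈ {M | M ∈ stratum σ ϖ T a ∧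
      LatticeInLevel ϖ ℓ (Matrix.diagonal ![(α - 1) * (α - 1), (β - 1) * (β - 1), 0]) M}, (kappaCount σ ϖ 0 i M : ℚ) * stabiliserWeight σ M) (fun j => (a j : ℕ)) =
      (if n₁ = n₂ ∧ n₂ = n₃ then ((((![normSign σ (-(1 + f₀)), normSign σ f₀ * normSign σ (-(1 + f₀)), normSign σ f₀] : Fin 3 → ℤ) i : ℤ) : ℚ))
      else if n₂ = n₃ then (![![(normSign σ (-1 : K) : ℚ) * normSign σ (1 + f₀), (normSign σ (-1 : K) : ℚ) * normSign σ f₀ * normSign σ (1 + f₀), (normSign σ f₀ : ℚ)],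
         ![(normSign σ (-1 : K) : ℚ) * normSign σ f₁ * normSign σ (1 + f₁), (normSign σ (-1 : K) : ℚ) * normSign σ (1 + f₁), (normSign σ f₁ : ℚ)],
         ![(normSign σ f₂ : ℚ), (normSign σ (-1 : K) : ℚ) * normSign σ f₂ * normSign σ (1 + f₂), (normSign σ (-1 : K) : ℚ) * normSign σ (1 + f₂)]] : Fin 3 → Fin 3 → ℚ) 0 i
      else if n₁ = n₃ then (![![(normSign σ (-1 : K) : ℚ) * normSign σ (1 + f₀), (normSign σ (-1 : K) : ℚ) * normSign σ f₀ * normSign σ (1 + f₀), (normSign σ f₀ : ℚ)],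
         ![(normSign σ (-1 : K) : ℚ) * normSign σ f₁ * normSign σ (1 + f₁), (normSign σ (-1 : K) : ℚ) * normSign σ (1 + f₁), (normSign σ f₁ : ℚ)],
         ![(normSign σ f₂ : ℚ), (normSign σ (-1 : K) : ℚ) * normSign σ f₂ * normSign σ (1 + f₂), (normSign σ (-1 : K) : ℚ) * normSign σ (1 + f₂)]] : Fin 3 → Fin 3 → ℚ) 1 i
      else (![![(normSign σ (-1 : K) : ℚ) * normSign σ (1 + f₀), (normSign σ (-1 : K) : ℚ) * normSign σ f₀ * normSign σ (1 + f₀), (normSign σ f₀ : ℚ)],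
         ![(normSign σ (-1 : K) : ℚ) * normSign σ f₁ * normSign σ (1 + f₁), (normSign σ (-1 : K) : ℚ) * normSign σ (1 + f₁), (normSign σ f₁ : ℚ)],
         ![(normSign σ f₂ : ℚ), (normSign σ (-1 : K) : ℚ) * normSign σ f₂ * normSign σ (1 + f₂), (normSign σ (-1 : K) : ℚ) * normSign σ (1 + f₂)]] : Fin 3 → Fin 3 → ℚ) 2 i) *
      (((q : ℚ) ^ (k - cs) - (q : ℚ) ^ (k - max cs ((nᵢ + 2 * (d % 2) + 2 - 3 * d) / 2))) / ((q : ℚ) - 1)) := by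
    rw [← mul_div_assoc, eq_div_iff hq1', mul_comm]
    exact key
  rw [hsum]
  ring

end Summit.HodgeConjecture.HodgeConjecture.Cruxes.H413.F0P3cDyRamSqLabelledTrunkOfBoxSum

end
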